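import Mathlib
import Summits.CriticalPhenomena.Ising3DConformalLimit.Theorems.PrecisionLaplacianEtaBoundsTransferZMatrix
import HarnessLib

/-!
# Symmetric potential kernels: sign, evenness, monotonicity of inverse entries in the index set

Helper file for item `stmt-CriticalPhenomena-4804`
(`Summit.CriticalPhenomena.Ising3DConformalLimit.Theses.PrecisionLaplacian.EtaBoundsTransfer`), part of its
unconditional proof: potential theory of inverse M-matrices ⇒ infinite-volume equation and Green-function
representation; Fourier analysis on `[-π,π]^d` ⇒ block-sum upper bounds; quadratic test function ⇒ ball-sum
lower bounds; Messager–Miracle-Solé ⇒ pointwise two-sided power bounds. No definitions are introduced: the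
objects (kernel matrices, box sequences, convolution powers) enter through defining hypotheses.
-/

namespace Summit.CriticalPhenomena.Ising3DConformalLimit.Theorems.EtaBoundsTransfer

open Matrix Finset

section Potential

variable {X : Type*} [AddCommGroup X] [DecidableEq X] {G : X → ℝ}
  {M : (A : Finset X) → Matrix A A ℝ}

omit [DecidableEq X] in
/-- Entries of the kernel matrix `M A = (G (q - p))_{p,q ∈ A}`. -/
theorem kerMat_apply (hM : ∀ A, M A = Matrix.of fun (p q : ↥A) => G (q.1 - p.1))
    (A : Finset X) (p q : ↥A) : M A p q = G (q.1 - p.1) := by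
  rw [hM]; rfl

/-- Sums over the two-element subtype `↥{0, x}`. -/
theorem sum_coe_pair {x : X} (hx0 : x ≠ 0) (f : X → ℝ) :
    ∑ u : ↥({0, x} : Finset X), f u.1 = f 0 + f x := by
  rw [Finset.sum_coe_sort ({0, x} : Finset X) f, Finset.sum_pair (Ne.symm hx0)]

variable (hM : ∀ A, M A = Matrix.of fun (p q : ↥A) => G (q.1 - p.1))
  (hSP : ∀ A : Finset X, (M A).PosDef ∧
    ∀ u v : ↥A, (u ≠ v → (M A)⁻¹ u v ≤ 0) ∧ 0 ≤ ∑ w, (M A)⁻¹ u w)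
include hM hSP

/-- Under the symmetric-potential hypothesis, `G 0 > 0` (the `1 × 1` matrix `(G 0)` is positive
definite). -/
theorem apply_zero_pos : 0 < G 0 := by
  have h := (hSP {0}).1.diag_pos (i := ⟨0, Finset.mem_singleton_self 0⟩)
  rw [kerMat_apply hM] at h
  simpa using h

/-- Under the symmetric-potential hypothesis, `G` is even (`M {0,x}` is symmetric). -/
theorem apply_neg (x : X) : G (-x) = G x := by
  have hH := (hSP {0, x}).1.isHermitian
  have h0 : (0 : X) ∈ ({0, x} : Finset X) := by simp
  have hx : x ∈ ({0, x} : Finset X) := by simp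
  have := hH.apply ⟨0, h0⟩ ⟨x, hx⟩
  rw [kerMat_apply hM, kerMat_apply hM] at this
  simpa using this

omit [AddCommGroup X] hM in
/-- Under the symmetric-potential hypothesis, the kernel matrices are invertible. -/
theorem isUnit_det_kerMat (A : Finset X) : IsUnit (M A).det :=
  (Matrix.isUnit_iff_isUnit_det _).mp (hSP A).1.isUnit

omit [AddCommGroup X] hM in
/-- Under the symmetric-potential hypothesis, `(M A)⁻¹⁻¹ = M A`. -/
theorem inv_inv_kerMat (A : Finset X) : (M A)⁻¹⁻¹ = M A :=
  Matrix.nonsing_inv_nonsing_inv _ (isUnit_det_kerMat hSP A)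

omit [AddCommGroup X] hM in
/-- Under the symmetric-potential hypothesis, the diagonal of `(M A)⁻¹` is positive. -/
theorem inv_kerMat_diag_pos (A : Finset X) (u : ↥A) : 0 < (M A)⁻¹ u u :=
  (hSP A).1.inv.diag_pos

/-- Under the symmetric-potential hypothesis, `G ≥ 0` (an inverse M-matrix is nonnegative). -/
theorem apply_nonneg (x : X) : 0 ≤ G x := by
  have h0 : (0 : X) ∈ ({0, x} : Finset X) := by simp
  have hx : x ∈ ({0, x} : Finset X) := by simp
  have hK : ((M {0, x})⁻¹).PosDef := (hSP {0, x}).1.inv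
  have hZ : ∀ i j, i ≠ j → (M {0, x})⁻¹ i j ≤ 0 := fun i j hij => ((hSP {0, x}).2 i j).1 hij
  have := inv_entry_nonneg_of_posDef_of_offDiag_nonpos hK hZ ⟨0, h0⟩ ⟨x, hx⟩
  rw [inv_inv_kerMat hSP, kerMat_apply hM] at this
  simpa using this

/-- Under the symmetric-potential hypothesis, `|G x| < G 0` for `x ≠ 0` (positive definiteness of
`M {0, x}` tested on the vector `G x · e_0 − G 0 · e_x`). -/
theorem abs_apply_lt_apply_zero {x : X} (hx0 : x ≠ 0) : |G x| < G 0 := by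
  have hx : x ∈ ({0, x} : Finset X) := by simp
  have hPD := (hSP {0, x}).1
  have hG0 := apply_zero_pos hM hSP
  set Z : X → ℝ := fun y => if y = 0 then G x else -G 0 with hZ
  set z : ↥({0, x} : Finset X) → ℝ := fun u => Z u.1 with hz
  have hz0 : z ≠ 0 := by
    intro h
    have := congr_fun h ⟨x, hx⟩
    simp only [hz, hZ, if_neg hx0, Pi.zero_apply, neg_eq_zero] at this
    exact hG0.ne' this
  have hpos := hPD.dotProduct_mulVec_pos hz0
  simp only [star_trivial] at hpos
  have heven := apply_neg hM hSP x
  have inner : ∀ a : X, ∑ v : ↥({0, x} : Finset X), G (v.1 - a) * Z v.1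
      = G (0 - a) * Z 0 + G (x - a) * Z x :=
    fun a => sum_coe_pair hx0 (fun b => G (b - a) * Z b)
  have hexp : z ⬝ᵥ ((M {0, x}) *ᵥ z) = G 0 * (G 0 ^ 2 - G x ^ 2) := by
    have h1 : z ⬝ᵥ ((M {0, x}) *ᵥ z)
        = ∑ u : ↥({0, x} : Finset X), Z u.1 * ∑ v : ↥({0, x} : Finset X), G (v.1 - u.1) * Z v.1 := by
      simp only [dotProduct, Matrix.mulVec, kerMat_apply hM, hz]
    rw [h1]
    simp_rw [inner]
    rw [sum_coe_pair hx0 (fun a => Z a * (G (0 - a) * Z 0 + G (x - a) * Z x))]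
    simp only [hZ, if_pos rfl, if_neg hx0, sub_zero, zero_sub, sub_self, heven]
    ring
  rw [hexp] at hpos
  have hsq : G x ^ 2 < G 0 ^ 2 := by
    by_contra h
    rw [not_lt] at h
    have : G 0 * (G 0 ^ 2 - G x ^ 2) ≤ 0 := mul_nonpos_of_nonneg_of_nonpos hG0.le (by linarith)
    linarith
  exact abs_lt_of_sq_lt_sq hsq hG0.le

/-- Under the symmetric-potential hypothesis, `G x < G 0` for `x ≠ 0`. -/
theorem apply_lt_apply_zero {x : X} (hx0 : x ≠ 0) : G x < G 0 :=
  lt_of_le_of_lt (le_abs_self _) (abs_apply_lt_apply_zero hM hSP hx0)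

/-- **Row identity** `((M A)⁻¹ · M A) u z = δ_{u z}`:
`∑_w (M A)⁻¹ u w · G (z − w) = [u = z]`. -/
theorem sum_inv_mul_apply (A : Finset X) (u z : ↥A) :
    ∑ w : ↥A, (M A)⁻¹ u w * G (z.1 - w.1) = if u = z then 1 else 0 := by
  have h := Matrix.nonsing_inv_mul (M A) (isUnit_det_kerMat hSP A)
  have := congr_fun (congr_fun h u) z
  simp only [Matrix.mul_apply, Matrix.one_apply] at this
  simp_rw [kerMat_apply hM] at this
  exact this

/-- The diagonal entry `(M A)⁻¹ 0 0` is at least `1 / G 0`. -/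
theorem inv_apply_zero_zero_ge {A : Finset X} (h0 : (0 : X) ∈ A) :
    1 / G 0 ≤ (M A)⁻¹ ⟨0, h0⟩ ⟨0, h0⟩ := by
  have hG0 := apply_zero_pos hM hSP
  have hid := sum_inv_mul_apply hM hSP A ⟨0, h0⟩ ⟨0, h0⟩
  rw [if_pos rfl, ← Finset.add_sum_erase _ _ (Finset.mem_univ (⟨0, h0⟩ : ↥A))] at hid
  have hrest : ∑ w ∈ (Finset.univ.erase (⟨0, h0⟩ : ↥A)), (M A)⁻¹ ⟨0, h0⟩ w * G ((0 : X) - w.1) ≤ 0 := by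
    apply Finset.sum_nonpos
    intro w hw
    have hne : (⟨0, h0⟩ : ↥A) ≠ w := fun h => (Finset.mem_erase.1 hw).1 h.symm
    exact mul_nonpos_of_nonpos_of_nonneg (((hSP A).2 _ _).1 hne) (apply_nonneg hM hSP _)
  have h1 : 1 ≤ (M A)⁻¹ ⟨0, h0⟩ ⟨0, h0⟩ * G 0 := by
    have : (M A)⁻¹ ⟨0, h0⟩ ⟨0, h0⟩ * G ((0:X) - (0:X)) = (M A)⁻¹ ⟨0, h0⟩ ⟨0, h0⟩ * G 0 := by
      rw [sub_self]
    linarith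
  rw [div_le_iff₀ hG0]
  exact h1

/-- **Uniform bound on the diagonal entry** `(M A)⁻¹ 0 0 ≤ 1 / (G 0 − s)` whenever
`G y ≤ s < G 0` for all `y ≠ 0` (row identity, Z-sign pattern and nonnegative row sums). -/
theorem inv_apply_zero_zero_le {A : Finset X} (h0 : (0 : X) ∈ A) {s : ℝ} (hs0 : 0 ≤ s)
    (hs : ∀ y, y ≠ 0 → G y ≤ s) (hsG : s < G 0) :
    (M A)⁻¹ ⟨0, h0⟩ ⟨0, h0⟩ ≤ 1 / (G 0 - s) := by
  set o : ↥A := ⟨0, h0⟩ with ho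
  have hid := sum_inv_mul_apply hM hSP A o o
  rw [if_pos rfl, ← Finset.add_sum_erase _ _ (Finset.mem_univ o)] at hid
  have hrow := ((hSP A).2 o o).2
  rw [← Finset.add_sum_erase _ _ (Finset.mem_univ o)] at hrow
  -- off-diagonal terms: `(M A)⁻¹ o w * G(-w) ≥ (M A)⁻¹ o w * s`
  have hrest : s * ∑ w ∈ Finset.univ.erase o, (M A)⁻¹ o w
      ≤ ∑ w ∈ Finset.univ.erase o, (M A)⁻¹ o w * G (o.1 - w.1) := by
    rw [Finset.mul_sum]
    apply Finset.sum_le_sum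
    intro w hw
    have hne : o ≠ w := fun h => (Finset.mem_erase.1 hw).1 h.symm
    have hw0 : w.1 ≠ 0 := by
      intro h
      apply hne
      exact Subtype.ext (by rw [ho]; exact h.symm)
    have hneg : o.1 - w.1 ≠ 0 := by
      rw [ho]; simpa using hw0
    have hcoef : (M A)⁻¹ o w ≤ 0 := ((hSP A).2 _ _).1 hne
    have hGw : G (o.1 - w.1) ≤ s := hs _ hneg
    nlinarith [hcoef, hGw, apply_nonneg hM hSP (o.1 - w.1)]
  have hoo : G (o.1 - o.1) = G 0 := by rw [sub_self]
  rw [hoo] at hid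
  -- `1 = k G0 + rest ≥ k G0 + s (rowsum - k) ≥ k G0 - s k`
  have hk : (M A)⁻¹ o o * (G 0 - s) ≤ 1 := by nlinarith [hid, hrest, hrow, hs0]
  rw [le_div_iff₀ (by linarith)]
  exact hk

omit hM in
/-- Nonnegative row sums: the off-diagonal mass of row `0` is bounded by the diagonal entry,
`∑_{w ≠ 0} (−(M A)⁻¹ 0 w) ≤ (M A)⁻¹ 0 0`. -/
theorem sum_neg_inv_le_diag {A : Finset X} (h0 : (0 : X) ∈ A) :
    ∑ w ∈ Finset.univ.erase (⟨0, h0⟩ : ↥A), -(M A)⁻¹ ⟨0, h0⟩ w ≤ (M A)⁻¹ ⟨0, h0⟩ ⟨0, h0⟩ := by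
  have hrow := ((hSP A).2 ⟨0, h0⟩ ⟨0, h0⟩).2
  rw [← Finset.add_sum_erase _ _ (Finset.mem_univ (⟨0, h0⟩ : ↥A))] at hrow
  rw [Finset.sum_neg_distrib]
  linarith

/-- **Monotonicity in the index set, one point at a time**: erasing a point `k` from `B` can only
decrease the entries of the inverse kernel matrix (bordering formula with the Z-sign pattern). -/
theorem inv_kerMat_erase_le {B : Finset X} {k : X} (hk : k ∈ B) {x y : X}
    (hx : x ∈ B.erase k) (hy : y ∈ B.erase k) :
    (M (B.erase k))⁻¹ ⟨x, hx⟩ ⟨y, hy⟩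
      ≤ (M B)⁻¹ ⟨x, Finset.mem_of_mem_erase hx⟩ ⟨y, Finset.mem_of_mem_erase hy⟩ := by
  set k' : ↥B := ⟨k, hk⟩ with hk'
  -- the equivalence `↥(B.erase k) ≃ {i : ↥B // i ≠ k'}`
  set e : ↥(B.erase k) ≃ {i : ↥B // i ≠ k'} :=
    { toFun := fun p => ⟨⟨p.1, Finset.mem_of_mem_erase p.2⟩,
        fun h => (Finset.mem_erase.1 p.2).1 (congrArg Subtype.val h)⟩
      invFun := fun i => ⟨i.1.1, Finset.mem_erase.2 ⟨fun h => i.2 (Subtype.ext h), i.1.2⟩⟩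
      left_inv := fun p => rfl
      right_inv := fun i => rfl } with he
  have hsub : M (B.erase k)
      = ((M B).submatrix (Subtype.val : {i : ↥B // i ≠ k'} → ↥B) Subtype.val).submatrix e e := by
    ext p q
    simp only [Matrix.submatrix_apply, kerMat_apply hM]
    rfl
  rw [hsub, Matrix.inv_submatrix_equiv]
  simp only [Matrix.submatrix_apply]
  have hxk : x ≠ k := (Finset.mem_erase.1 hx).1
  have hyk : y ≠ k := (Finset.mem_erase.1 hy).1
  have h1 := inv_submatrix_ne_apply_le (M B) (isUnit_det_kerMat hSP B) k'
    (inv_kerMat_diag_pos hSP B k') (e ⟨x, hx⟩) (e ⟨y, hy⟩)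
    (((hSP B).2 _ _).1 (fun h => hxk (congrArg Subtype.val h)))
    (((hSP B).2 _ _).1 (fun h => hyk (congrArg Subtype.val h).symm))
  exact h1

/-- **Monotonicity in the index set**: for `A ⊆ B` the entries of `(M A)⁻¹` are bounded by the
corresponding entries of `(M B)⁻¹` (iterate `inv_kerMat_erase_le`). In particular
`−(M A)⁻¹ 0 x` decreases and `(M A)⁻¹ 0 0` increases as `A` grows. -/
theorem inv_kerMat_mono {A B : Finset X} (hAB : A ⊆ B) {x y : X} (hxA : x ∈ A) (hyA : y ∈ A)
    (hxB : x ∈ B) (hyB : y ∈ B) :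
    (M A)⁻¹ ⟨x, hxA⟩ ⟨y, hyA⟩ ≤ (M B)⁻¹ ⟨x, hxB⟩ ⟨y, hyB⟩ := by
  -- induction on the number of extra points
  suffices h : ∀ (n : ℕ) (B : Finset X) (hxB : x ∈ B) (hyB : y ∈ B), A ⊆ B → (B \ A).card = n →
      (M A)⁻¹ ⟨x, hxA⟩ ⟨y, hyA⟩ ≤ (M B)⁻¹ ⟨x, hxB⟩ ⟨y, hyB⟩ from
    h _ B hxB hyB hAB rfl
  intro n
  induction n with
  | zero =>
    intro B hxB hyB hAB hcard
    have hBA : B ⊆ A := by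
      intro b hb
      by_contra hbA
      have : b ∈ B \ A := Finset.mem_sdiff.2 ⟨hb, hbA⟩
      rw [Finset.card_eq_zero] at hcard
      rw [hcard] at this
      simp at this
    have hEq : A = B := Finset.Subset.antisymm hAB hBA
    subst hEq
    exact le_rfl
  | succ n ih =>
    intro B hxB hyB hAB hcard
    obtain ⟨k, hk⟩ : (B \ A).Nonempty := by
      rw [← Finset.card_pos, hcard]; exact Nat.succ_pos n
    have hkB : k ∈ B := (Finset.mem_sdiff.1 hk).1
    have hkA : k ∉ A := (Finset.mem_sdiff.1 hk).2
    have hAB' : A ⊆ B.erase k := fun a ha =>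
      Finset.mem_erase.2 ⟨fun h => hkA (h ▸ ha), hAB ha⟩
    have hcard' : (B.erase k \ A).card = n := by
      have : B.erase k \ A = (B \ A).erase k := by
        ext b; simp [Finset.mem_erase, Finset.mem_sdiff]; tauto
      rw [this, Finset.card_erase_of_mem hk, hcard]; rfl
    have hxE : x ∈ B.erase k := hAB' hxA
    have hyE : y ∈ B.erase k := hAB' hyA
    exact (ih (B.erase k) hxE hyE hAB' hcard').trans (inv_kerMat_erase_le hM hSP hkB hxE hyE)

/-- **Reflection symmetry**: if `A` is symmetric under negation then
`(M A)⁻¹ (−x) (−y) = (M A)⁻¹ x y` (evenness of `G`). -/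
theorem inv_kerMat_neg {A : Finset X} (hA : ∀ x, x ∈ A → -x ∈ A) {x y : X} (hx : x ∈ A)
    (hy : y ∈ A) :
    (M A)⁻¹ ⟨-x, hA x hx⟩ ⟨-y, hA y hy⟩ = (M A)⁻¹ ⟨x, hx⟩ ⟨y, hy⟩ := by
  have hA' : ∀ x, -x ∈ A → x ∈ A := fun x h => by simpa using hA (-x) h
  set e : ↥A ≃ ↥A :=
    { toFun := fun p => ⟨-p.1, hA _ p.2⟩
      invFun := fun p => ⟨-p.1, hA _ p.2⟩
      left_inv := fun p => by simp
      right_inv := fun p => by simp } with he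
  have hsub : M A = (M A).submatrix e e := by
    ext p q
    simp only [Matrix.submatrix_apply, kerMat_apply hM, he, Equiv.coe_fn_mk]
    rw [← apply_neg hM hSP]
    congr 1; abel
  have h := congr_arg (fun N : Matrix A A ℝ => N⁻¹ ⟨x, hx⟩ ⟨y, hy⟩) hsub
  simp only [Matrix.inv_submatrix_equiv, Matrix.submatrix_apply] at h
  rw [h]
  rfl

end Potential

end Summit.CriticalPhenomena.Ising3DConformalLimit.Theorems.EtaBoundsTransfer
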